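import Literature.NumberTheory.ModularForms.JacobiForms
import Mathlib.NumberTheory.ModularForms.LevelOne.DimensionFormula
import Mathlib.Analysis.Normed.Module.FiniteDimension
import HarnessLib

/-!
# Jacobi forms of index `0` are the modular forms: `J_{k,0} = M_k(SL₂(ℤ))` (Eichler–Zagier, Ch. I §1)

M. Eichler, D. Zagier, *The Theory of Jacobi Forms* (Progress in Mathematics 55, Birkhäuser 1985),
Ch. I §1, the consequences of **Theorem 1.2** (not held — `acq-10245`; quoted from the held secondary
K. Liu, X. Ma, *On family rigidity theorems II*, arXiv:math/9911035, Lemma 1.4 and the lines after it,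
`paper:arxiv-math_9911035` p0006 L102–L110, verbatim): "The following lemma was established in
[EZ, Theorem 1.2]: **Lemma 1.4.** Let `F` be a holomorphic Jacobi form of index `m` and weight `k`. Then
for fixed `τ`, `F(t, τ)`, if not identically zero, has exactly `2m` zeros in any fundamental domain for
the action of the lattice on `ℂ`. This tells us that there are no holomorphic Jacobi forms of negative
index. […] If `m = 0`, it is easy to see that `F` must be independent of `t`." — whence Eichler–Zagier's
standing identification `J_{k,0} = M_k` (used in Ch. I §3 and Ch. III §8–§9 for the structure of
`J_{*,*}` as a module over `M_* = ⊕ M_k(SL₂(ℤ))`).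

Row g39-#3 of the `lit-hodgefound` lane (prover p25, generation 39), sequel of `JacobiForms.lean`
(g39-#1). THEOREMS ONLY; the modular forms are Mathlib's `ModularForm 𝒮ℒ k` (level one). Our road to
"independent of `z`" is not Theorem 1.2 (the count of zeros) but the Fourier development (J-3) directly:
for `m = 0` the support condition `r² ≤ 4mn = 0` kills every `r ≠ 0`.

## What is proved (namespace `IsJacobiForm`)

* `apply_eq_apply_zero_of_index_zero`: `φ ∈ J_{k,0}` ⇒ `φ(τ, z) = φ(τ, 0)` on `{Im τ > 0} × ℂ`.
* `norm_apply_zero_le_of_one_le_im`: `τ ↦ φ(τ, 0)` is bounded on `Im τ ≥ 1` (from (J-3), any index).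
* **`exists_modularForm_of_index_zero`**: for `φ ∈ J_{k,0}` there is a level-one modular form
  `f : ModularForm 𝒮ℒ k` with `f(τ) = φ(τ, 0)`; with g39-#1's `isJacobiForm_of_modularForm` this is
  **`J_{k,0} = M_k`**; `exists_modularForm_eq_of_index_zero` (`φ(τ, z) = f(τ)` for all `z`).
* transported from Mathlib's level-one theory: `eq_zero_of_index_zero_of_weight_neg` (`k < 0`),
  `eq_zero_of_index_zero_of_odd` (`k` odd), `eq_zero_of_index_zero_of_weight_two` (`k = 2`),
  `exists_eq_const_of_index_zero_of_weight_zero` (`k = 0`: constants).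
* §5, ANY index `m` (Eichler–Zagier Ch. I §3, the Taylor coefficient `ν = 0`): **`exists_modularForm_apply_zero`**
  (`φ(·, 0) ∈ M_k`), `apply_zero_eq_zero_of_odd` (`k` odd ⇒ `φ(τ, 0) = 0`),
  `IsJacobiCuspForm.norm_apply_zero_le_exp`, **`IsJacobiCuspForm.exists_cuspForm_apply_zero`** (`φ(·, 0) ∈ S_k`).

## References

* [EichlerZagier1985] M. Eichler, D. Zagier, *The Theory of Jacobi Forms*, Progress in Math. 55
  (1985), Ch. I §1 Theorem 1.2 and the remark following it; §3 (`J_{k,0} = M_k`).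
* [LiuMa1999FamilyRigidityII] K. Liu, X. Ma, *On family rigidity theorems II*, arXiv:math/9911035
  (1999), Lemma 1.4 (restates [EZ, Theorem 1.2] and its consequences for `m ≤ 0`).
* [Ibukiyama2012] T. Ibukiyama, *Taylor expansions of Jacobi forms and applications to explicit structures of
  degree two*, Publ. RIMS 48 (2012), 579–613, §3 p. 583 ("EZ 1"–"EZ 3", restating [EZ, Ch. I §3]; held
  `paper:doi-10-2977-prims-82` p0005 L5–L19). doi:10.2977/prims/82
-/

noncomputable section

open scoped MatrixGroups Manifold Real ModularForm
open Complex
open UpperHalfPlane hiding I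

namespace Literature.NumberTheory.ModularForms

namespace IsJacobiForm

variable {k : ℤ} {m : ℕ} {φ : ℂ → ℂ → ℂ}

/-! ## §1 Index `0`: `φ` does not depend on `z` -/

/-- **A Jacobi form of index `0` is independent of `z`**: `φ(τ, z) = φ(τ, 0)` — in its Fourier
development only `r = 0` occurs (`r² ≤ 4·0·n`). [cite: EichlerZagier1985, Ch. I §1 Theorem 1.2 (remark following it)]
[cite: LiuMa1999FamilyRigidityII, Lemma 1.4] -/
theorem apply_eq_apply_zero_of_index_zero (h : IsJacobiForm k 0 φ) {τ : ℂ} (hτ : 0 < τ.im) (z : ℂ) :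
    φ τ z = φ τ 0 := by
  obtain ⟨c, hc, hs⟩ := h.hasSum_coeff
  have key : ∀ w : ℂ,
      HasSum (fun p : ℤ × ℤ => c p.1 p.2 * cexp (2 * π * I * (p.1 * τ))) (φ τ w) := by
    intro w
    refine (hs τ w hτ).congr_fun fun p => ?_
    by_cases hp : c p.1 p.2 = 0
    · simp [hp]
    · have h2 : p.2 ^ 2 ≤ 0 := by simpa using (hc _ _ hp).2
      have hr : p.2 = 0 := pow_eq_zero_iff (n := 2) (by norm_num) |>.mp
        (le_antisymm h2 (sq_nonneg _))
      simp [hr]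
  exact (key z).unique (key 0)

/-! ## §2 `τ ↦ φ(τ, 0)` is bounded at `i∞` -/

/-- For any Jacobi form, `|φ(τ, 0)| ≤ Σ_{n,r} |c(n, r)| e^{-2πn}` on `Im τ ≥ 1` (the terms of (J-3) have
`n ≥ 0`). [cite: EichlerZagier1985, Ch. I §1 (p. 9), (J-3)] -/
theorem norm_apply_zero_le_of_one_le_im (h : IsJacobiForm k m φ) :
    ∃ M : ℝ, ∀ τ : ℂ, 1 ≤ τ.im → ‖φ τ 0‖ ≤ M := by
  obtain ⟨c, hc, hs⟩ := h.hasSum_coeff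
  -- the majorant: the absolute series at `τ = i`
  have hI : (0 : ℝ) < (I : ℂ).im := by simp
  have hsI : Summable fun p : ℤ × ℤ => ‖c p.1 p.2 * cexp (2 * π * I * (p.1 * I + p.2 * (0 : ℂ)))‖ :=
    summable_norm_iff.mpr (hs I 0 hI).summable
  refine ⟨∑' p : ℤ × ℤ, ‖c p.1 p.2 * cexp (2 * π * I * (p.1 * I + p.2 * (0 : ℂ)))‖, fun τ hτ => ?_⟩
  have hτ0 : 0 < τ.im := lt_of_lt_of_le one_pos hτ
  have hsτ : Summable fun p : ℤ × ℤ => ‖c p.1 p.2 * cexp (2 * π * I * (p.1 * τ + p.2 * (0 : ℂ)))‖ :=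
    summable_norm_iff.mpr (hs τ 0 hτ0).summable
  have hle : ∀ p : ℤ × ℤ, ‖c p.1 p.2 * cexp (2 * π * I * (p.1 * τ + p.2 * (0 : ℂ)))‖ ≤
      ‖c p.1 p.2 * cexp (2 * π * I * (p.1 * I + p.2 * (0 : ℂ)))‖ := by
    intro p
    by_cases hp : c p.1 p.2 = 0
    · simp [hp]
    · have hn : (0 : ℝ) ≤ p.1 := by exact_mod_cast (hc _ _ hp).1
      rw [norm_mul, norm_mul, Complex.norm_exp, Complex.norm_exp]
      have e1 : (2 * ↑π * I * (↑p.1 * τ + ↑p.2 * 0)).re = -(2 * π * p.1 * τ.im) := by simp; ring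
      have e2 : (2 * ↑π * I * (↑p.1 * I + ↑p.2 * (0 : ℂ))).re = -(2 * π * p.1) := by simp
      rw [e1, e2]
      refine mul_le_mul_of_nonneg_left (Real.exp_le_exp.mpr ?_) (norm_nonneg _)
      have : (p.1 : ℝ) * 1 ≤ p.1 * τ.im := by gcongr
      nlinarith [Real.pi_pos]
  calc ‖φ τ 0‖ = ‖∑' p : ℤ × ℤ, c p.1 p.2 * cexp (2 * π * I * (p.1 * τ + p.2 * (0 : ℂ)))‖ := by
        rw [(hs τ 0 hτ0).tsum_eq]
    _ ≤ ∑' p : ℤ × ℤ, ‖c p.1 p.2 * cexp (2 * π * I * (p.1 * τ + p.2 * (0 : ℂ)))‖ :=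
        norm_tsum_le_tsum_norm hsτ
    _ ≤ _ := hsτ.tsum_le_tsum hle hsI

/-! ## §3 `J_{k,0} = M_k(SL₂(ℤ))` -/

/-- **`J_{k,0} ⊆ M_k`**: for a Jacobi form `φ` of index `0`, `τ ↦ φ(τ, 0)` is a level-one modular form
of weight `k` (Mathlib's `ModularForm 𝒮ℒ k`): holomorphic on `ℍ`, `φ(γτ, 0) = (cτ+d)^k φ(τ, 0)` by (J-1)
at `z = 0`, bounded at `i∞` by (J-3). Together with `isJacobiForm_of_modularForm` (g39-#1): `J_{k,0} = M_k`.
[cite: EichlerZagier1985, Ch. I §1 Theorem 1.2 (remark following it) and §3]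
[cite: LiuMa1999FamilyRigidityII, Lemma 1.4] -/
theorem exists_modularForm_of_index_zero (h : IsJacobiForm k 0 φ) :
    ∃ f : ModularForm 𝒮ℒ k, ∀ τ : ℍ, f τ = φ τ 0 := by
  set g : ℍ → ℂ := fun τ => φ τ 0 with hg
  -- (J-1) at `z = 0`
  have hslash : ∀ γ : SL(2, ℤ), g ∣[k] γ = g := by
    intro γ
    ext τ
    rw [ModularForm.SL_slash_apply]
    have h1 := h.apply_smul γ τ 0
    simp only [zero_div, ne_eq, OfNat.ofNat_ne_zero, not_false_eq_true, zero_pow, mul_zero,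
      Complex.exp_zero, mul_one] at h1
    simp only [hg, h1]
    have hd : denom (γ : GL (Fin 2) ℝ) τ ≠ 0 := denom_ne_zero _ _
    rw [mul_comm, ← mul_assoc, ← zpow_add₀ hd, neg_add_cancel, zpow_zero, one_mul]
  -- holomorphy
  have hmd : MDifferentiable 𝓘(ℂ) 𝓘(ℂ) g := by
    refine UpperHalfPlane.mdifferentiable_iff.mpr ?_
    refine (h.differentiableOn_left 0).congr fun τ hτ => ?_
    simp [hg, Function.comp_apply, ofComplex_apply_of_im_pos hτ]
  -- boundedness at `i∞`
  have hbdd : IsBoundedAtImInfty g := by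
    obtain ⟨M, hM⟩ := h.norm_apply_zero_le_of_one_le_im
    exact (isBoundedAtImInfty_iff).mpr ⟨M, 1, fun τ hτ => hM τ hτ⟩
  refine ⟨{ toFun := g
            slash_action_eq' := fun γ hγ => ?_
            holo' := hmd
            bdd_at_cusps' := fun hc => ?_ }, fun τ => rfl⟩
  · obtain ⟨γ', rfl⟩ := hγ
    have h := hslash γ'
    rwa [ModularForm.SL_slash] at h
  · exact (OnePoint.isBoundedAt_iff_forall_SL2Z hc).mpr fun γ _ => by
      rw [hslash γ]; exact hbdd

/-- `J_{k,0} = M_k`, pointwise form: `φ(τ, z) = f(τ)` for a level-one modular form `f` and ALL `z`.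
[cite: EichlerZagier1985, Ch. I §1 Theorem 1.2 (remark following it) and §3] -/
theorem exists_modularForm_eq_of_index_zero (h : IsJacobiForm k 0 φ) :
    ∃ f : ModularForm 𝒮ℒ k, ∀ (τ : ℍ) (z : ℂ), φ τ z = f τ := by
  obtain ⟨f, hf⟩ := h.exists_modularForm_of_index_zero
  exact ⟨f, fun τ z => by rw [hf, h.apply_eq_apply_zero_of_index_zero τ.im_pos]⟩

/-! ## §4 Consequences of the level-one theory (Mathlib) for `J_{k,0}` -/

/-- `J_{k,0} = 0` for `k < 0` (`M_k(SL₂(ℤ)) = 0`). [cite: EichlerZagier1985, Ch. I §1 (`J_{k,0} = M_k`)] -/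
theorem eq_zero_of_index_zero_of_weight_neg (h : IsJacobiForm k 0 φ) (hk : k < 0) {τ : ℂ}
    (hτ : 0 < τ.im) (z : ℂ) : φ τ z = 0 := by
  obtain ⟨f, hf⟩ := h.exists_modularForm_eq_of_index_zero
  have h0 : (⇑f : ℍ → ℂ) = 0 := ModularFormClass.levelOne_neg_weight_eq_zero hk f
  simpa [h0] using hf ⟨τ, hτ⟩ z

/-- `J_{k,0} = 0` for odd `k` (`M_k(SL₂(ℤ)) = 0`). [cite: EichlerZagier1985, Ch. I §1 (`J_{k,0} = M_k`)] -/
theorem eq_zero_of_index_zero_of_odd (h : IsJacobiForm k 0 φ) (hk : Odd k) {τ : ℂ}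
    (hτ : 0 < τ.im) (z : ℂ) : φ τ z = 0 := by
  obtain ⟨f, hf⟩ := h.exists_modularForm_eq_of_index_zero
  have h0 : f = 0 := ModularForm.levelOne_odd_weight_eq_zero hk f
  simpa [h0] using hf ⟨τ, hτ⟩ z

/-- `J_{2,0} = 0` (`M_2(SL₂(ℤ)) = 0`). [cite: EichlerZagier1985, Ch. I §1 (`J_{k,0} = M_k`)] -/
theorem eq_zero_of_index_zero_of_weight_two {φ : ℂ → ℂ → ℂ} (h : IsJacobiForm 2 0 φ) {τ : ℂ}
    (hτ : 0 < τ.im) (z : ℂ) : φ τ z = 0 := by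
  obtain ⟨f, hf⟩ := h.exists_modularForm_eq_of_index_zero
  have h0 : f = 0 := (rank_zero_iff_forall_zero.mp ModularForm.levelOne_weight_two_rank_zero) f
  simpa [h0] using hf ⟨τ, hτ⟩ z

/-- `J_{0,0} = ℂ`: a Jacobi form of weight `0` and index `0` is constant on `{Im τ > 0} × ℂ`.
[cite: EichlerZagier1985, Ch. I §1 (`J_{k,0} = M_k`)] -/
theorem exists_eq_const_of_index_zero_of_weight_zero {φ : ℂ → ℂ → ℂ} (h : IsJacobiForm 0 0 φ) :
    ∃ a : ℂ, ∀ τ z : ℂ, 0 < τ.im → φ τ z = a := by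
  obtain ⟨f, hf⟩ := h.exists_modularForm_eq_of_index_zero
  obtain ⟨a, ha⟩ := ModularFormClass.levelOne_weight_zero_const f
  exact ⟨a, fun τ z hτ => by rw [hf ⟨τ, hτ⟩ z, ha]; rfl⟩

/-! ## §5 Any index: `φ(τ, 0) ∈ M_k` (and `∈ S_k` for cusp forms) — Eichler–Zagier Ch. I §3, `ν = 0` -/

/-- **`φ(τ, 0) ∈ M_k` for a Jacobi form of ANY index** (Eichler–Zagier, Ch. I §3: the Taylor coefficient
`χ₀ = ξ₀ = φ(·, 0)` of the development `φ(τ, z) = Σ_ν χ_ν(τ) z^ν` is a modular form of weight `k`; Ibukiyama: "EZ 1. … we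
can construct a modular form `ξ_{k+ν}(τ) ∈ M_{k+ν}(Γ₁)` from the Taylor coefficients", `ξ_{k,0} = f₀`): holomorphic on
`ℍ`, `φ(γτ, 0) = (cτ+d)^k φ(τ, 0)` by (J-1) at `z = 0`, bounded at `i∞` by (J-3) — the proof of
`exists_modularForm_of_index_zero` verbatim. [cite: EichlerZagier1985, Ch. I §3 (3) and Theorem 3.1 (ν = 0)]
[cite: Ibukiyama2012, §3 "EZ 1" (p. 583)] -/
theorem exists_modularForm_apply_zero (h : IsJacobiForm k m φ) :
    ∃ f : ModularForm 𝒮ℒ k, ∀ τ : ℍ, f τ = φ τ 0 := by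
  set g : ℍ → ℂ := fun τ => φ τ 0 with hg
  have hslash : ∀ γ : SL(2, ℤ), g ∣[k] γ = g := by
    intro γ
    ext τ
    rw [ModularForm.SL_slash_apply]
    have h1 := h.apply_smul γ τ 0
    simp only [zero_div, ne_eq, OfNat.ofNat_ne_zero, not_false_eq_true, zero_pow, mul_zero,
      zero_div, Complex.exp_zero, mul_one] at h1
    simp only [hg, h1]
    have hd : denom (γ : GL (Fin 2) ℝ) τ ≠ 0 := denom_ne_zero _ _
    rw [mul_comm, ← mul_assoc, ← zpow_add₀ hd, neg_add_cancel, zpow_zero, one_mul]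
  have hmd : MDifferentiable 𝓘(ℂ) 𝓘(ℂ) g := by
    refine UpperHalfPlane.mdifferentiable_iff.mpr ?_
    refine (h.differentiableOn_left 0).congr fun τ hτ => ?_
    simp [hg, Function.comp_apply, ofComplex_apply_of_im_pos hτ]
  have hbdd : IsBoundedAtImInfty g := by
    obtain ⟨M, hM⟩ := h.norm_apply_zero_le_of_one_le_im
    exact (isBoundedAtImInfty_iff).mpr ⟨M, 1, fun τ hτ => hM τ hτ⟩
  refine ⟨{ toFun := g
            slash_action_eq' := fun γ hγ => ?_
            holo' := hmd
            bdd_at_cusps' := fun hc => ?_ }, fun τ => rfl⟩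
  · obtain ⟨γ', rfl⟩ := hγ
    have h := hslash γ'
    rwa [ModularForm.SL_slash] at h
  · exact (OnePoint.isBoundedAt_iff_forall_SL2Z hc).mpr fun γ _ => by
      rw [hslash γ]; exact hbdd

/-- For ODD weight `φ(τ, 0) = 0` (`φ(τ, −z) = (−1)^k φ(τ, z)`: "`F(τ, z)` is an even or odd function of `z` if `nk`
is even or odd"), so the Taylor development starts at `z¹`. [cite: Ibukiyama2012, §3 (p. 583)]
[cite: EichlerZagier1985, Ch. I §2 Theorem 2.2 (p. 23), §3] -/
theorem apply_zero_eq_zero_of_odd (h : IsJacobiForm k m φ) (hk : Odd k) {τ : ℂ} (hτ : 0 < τ.im) :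
    φ τ 0 = 0 := by
  have h1 := h.apply_neg hτ 0
  rw [neg_zero, hk.neg_one_zpow, neg_one_mul] at h1
  have h2 : (2 : ℂ) * φ τ 0 = 0 := by linear_combination h1
  simpa using h2

end IsJacobiForm

namespace IsJacobiCuspForm

variable {k : ℤ} {m : ℕ} {φ : ℂ → ℂ → ℂ}

/-- For a Jacobi CUSP form `|φ(τ, 0)| ≤ M e^{−2π(Im τ − 1)}` on `Im τ ≥ 1`: only `n ≥ 1` occurs in (J-3) (`r² < 4mn`
forces `n > 0`). [cite: EichlerZagier1985, Ch. I §1 (p. 9), (J-3) for cusp forms; §3] -/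
theorem norm_apply_zero_le_exp (h : IsJacobiCuspForm k m φ) :
    ∃ M : ℝ, ∀ τ : ℂ, 1 ≤ τ.im → ‖φ τ 0‖ ≤ M * Real.exp (-(2 * π * (τ.im - 1))) := by
  obtain ⟨c, hc, hs⟩ := h.hasSum_coeff_cusp
  have hI : (0 : ℝ) < (I : ℂ).im := by simp
  have hsI : Summable fun p : ℤ × ℤ => ‖c p.1 p.2 * cexp (2 * π * I * (p.1 * I + p.2 * (0 : ℂ)))‖ :=
    summable_norm_iff.mpr (hs I 0 hI).summable
  refine ⟨∑' p : ℤ × ℤ, ‖c p.1 p.2 * cexp (2 * π * I * (p.1 * I + p.2 * (0 : ℂ)))‖, fun τ hτ => ?_⟩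
  have hτ0 : 0 < τ.im := lt_of_lt_of_le one_pos hτ
  have hsτ : Summable fun p : ℤ × ℤ => ‖c p.1 p.2 * cexp (2 * π * I * (p.1 * τ + p.2 * (0 : ℂ)))‖ :=
    summable_norm_iff.mpr (hs τ 0 hτ0).summable
  -- for a cusp form only `n ≥ 1` occurs: `c(n, r) ≠ 0 ⇒ r² < 4mn ⇒ n ≥ 1`
  have hn1 : ∀ p : ℤ × ℤ, c p.1 p.2 ≠ 0 → (1 : ℝ) ≤ p.1 := fun p hp => by
    have h1 := hc _ _ hp
    have : 0 < p.1 := by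
      by_contra hle
      push Not at hle
      have : (4 : ℤ) * m * p.1 ≤ 0 := by nlinarith
      nlinarith [sq_nonneg p.2]
    exact_mod_cast this
  have hle : ∀ p : ℤ × ℤ, ‖c p.1 p.2 * cexp (2 * π * I * (p.1 * τ + p.2 * (0 : ℂ)))‖ ≤
      ‖c p.1 p.2 * cexp (2 * π * I * (p.1 * I + p.2 * (0 : ℂ)))‖ * Real.exp (-(2 * π * (τ.im - 1))) := by
    intro p
    by_cases hp : c p.1 p.2 = 0
    · simp [hp]
    · have hn := hn1 p hp
      rw [norm_mul, norm_mul, Complex.norm_exp, Complex.norm_exp]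
      have e1 : (2 * ↑π * I * (↑p.1 * τ + ↑p.2 * 0)).re = -(2 * π * p.1 * τ.im) := by simp; ring
      have e2 : (2 * ↑π * I * (↑p.1 * I + ↑p.2 * (0 : ℂ))).re = -(2 * π * p.1) := by simp
      rw [e1, e2, mul_assoc ‖c p.1 p.2‖, ← Real.exp_add]
      refine mul_le_mul_of_nonneg_left (Real.exp_le_exp.mpr ?_) (norm_nonneg _)
      have h0 : 0 ≤ τ.im - 1 := by linarith
      nlinarith [Real.pi_pos, mul_nonneg (mul_nonneg Real.pi_pos.le (sub_nonneg.mpr hn)) h0]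
  calc ‖φ τ 0‖ = ‖∑' p : ℤ × ℤ, c p.1 p.2 * cexp (2 * π * I * (p.1 * τ + p.2 * (0 : ℂ)))‖ := by
        rw [(hs τ 0 hτ0).tsum_eq]
    _ ≤ ∑' p : ℤ × ℤ, ‖c p.1 p.2 * cexp (2 * π * I * (p.1 * τ + p.2 * (0 : ℂ)))‖ :=
        norm_tsum_le_tsum_norm hsτ
    _ ≤ ∑' p : ℤ × ℤ, ‖c p.1 p.2 * cexp (2 * π * I * (p.1 * I + p.2 * (0 : ℂ)))‖ *
          Real.exp (-(2 * π * (τ.im - 1))) := hsτ.tsum_le_tsum hle (hsI.mul_right _)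
    _ = _ := tsum_mul_right

/-- **`φ(τ, 0) ∈ S_k` for a Jacobi cusp form** of any index: the modular form `φ(·, 0)` tends to `0` at `i∞`, hence
(level one: every cusp is `SL₂(ℤ)`-equivalent to `i∞`) is a cusp form. [cite: EichlerZagier1985, Ch. I §3 (3) and Theorem 3.1 (ν = 0)]
[cite: Ibukiyama2012, §3 "EZ 1" (p. 583)] -/
theorem exists_cuspForm_apply_zero (h : IsJacobiCuspForm k m φ) :
    ∃ f : CuspForm 𝒮ℒ k, ∀ τ : ℍ, f τ = φ τ 0 := by
  obtain ⟨f, hf⟩ := h.isJacobiForm.exists_modularForm_apply_zero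
  have hzero : UpperHalfPlane.IsZeroAtImInfty f := by
    obtain ⟨M, hM⟩ := h.norm_apply_zero_le_exp
    rw [UpperHalfPlane.IsZeroAtImInfty, Filter.ZeroAtFilter]
    have h1 : Filter.Tendsto UpperHalfPlane.im atImInfty Filter.atTop := Filter.tendsto_comap
    have h2 : Filter.Tendsto (fun t : ℝ => 2 * π * (t + -1)) Filter.atTop Filter.atTop :=
      (Filter.tendsto_atTop_add_const_right _ _ Filter.tendsto_id).const_mul_atTop (by positivity)
    have h3 := ((Real.tendsto_exp_neg_atTop_nhds_zero.comp h2).comp h1).const_mul M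
    rw [mul_zero] at h3
    refine squeeze_zero_norm' ?_ h3
    rw [Filter.Eventually, UpperHalfPlane.atImInfty_mem]
    refine ⟨1, fun τ hτ => ?_⟩
    have := hM τ (by simpa using hτ)
    simp only [Set.mem_setOf_eq, Function.comp_apply, hf]
    convert this using 2
    simp only [UpperHalfPlane.coe_im, sub_eq_add_neg]
  refine ⟨{ toSlashInvariantForm := f.toSlashInvariantForm
            holo' := f.holo'
            zero_at_cusps' := fun {c} hc => ?_ }, fun τ => hf τ⟩
  rw [Subgroup.IsArithmetic.isCusp_iff_isCusp_SL2Z] at hc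
  rw [OnePoint.isZeroAt_iff_forall_SL2Z hc]
  intro γ _
  rw [show (f.toFun ∣[k] γ) = ⇑f from f.slash_action_eq' _ ⟨γ, rfl⟩]
  exact hzero

end IsJacobiCuspForm

end Literature.NumberTheory.ModularForms
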